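import Mathlib.GroupTheory.Index
import Mathlib.GroupTheory.PGroup
import Mathlib.GroupTheory.QuotientGroup.Basic
import Mathlib.GroupTheory.Coset.Card
import Mathlib.Data.ZMod.Basic
import Mathlib.Algebra.Field.ZMod
import Mathlib.Data.Fin.VecNotation
import Mathlib.Tactic.Ring
import Mathlib.Tactic.FinCases
import Mathlib.Tactic.Abel
import Mathlib.Tactic.LinearCombination
import HarnessLib

/-!
# A special `p`-group of order `p⁶` with `G/Z(G) ≅ C_p³` and NO abelian subgroup of index `p`;
this REFUTES Murthy 2026, Prop. 2.17 (2) as printed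

Topic `Literature/GroupTheory/SpecificGroups`.

S. R. Murthy, *On the triple product property for subgroups of finite nilpotent groups of class 2*,
arXiv:2602.15796 (2026; v1, the only version on 2026-08-23), p. 11, verbatim:

> **Proposition 2.17.** If `G` is a `p`-group such that `G/Z(G)` is elementary abelian of order `p²`
> or abelian of order `p³` then `G` contains abelian (maximal, normal) subgroups of index `p`.

and its use, p. 16 (proof of Thm. 5.1, "If `G` is a `p`-group of nilpotency class 2 such that
`p² ≤ |G:Z(G)| ≤ p³` then `ρ₀(G) = 1`"): «However, by Proposition 2.17 `G` contains abelian (maximal,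
normal) subgroups of index `p`, and by [9, Corollary 4.3] `ρ₀(G) = 1`.»

**The counterexample** (every prime `p`). `G_p = 𝔽_p³ × 𝔽_p³` with
`(a, s)(b, t) = (a + b, s + t + B(a, b))`, `B(a, b) = (a₀b₁, a₀b₂, a₁b₂)` — a group for the same
reason as any Heisenberg-type group (associativity = bilinearity of `B`).  Two elements commute iff
`B(a, b) = B(b, a)`, i.e. iff the three `2 × 2` minors `a₀b₁ − a₁b₀, a₀b₂ − a₂b₀, a₁b₂ − a₂b₁` vanish,
i.e. iff `a, b` are linearly dependent.  Hence `Z(G_p) = 0 × 𝔽_p³` (order `p³`), `|G_p| = p⁶`,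
`G_p/Z(G_p)` is abelian of order `p³` (so `G_p` is a `p`-group of class `2` inside the hypotheses of
Prop. 2.17 (2) and of Thm. 5.1), and an ABELIAN subgroup `M` projects onto a set of pairwise dependent
vectors, which has at most `p` elements, so `|M| ≤ p · p³ = p⁴ < p⁵`: no abelian subgroup has index
`p`.  (For `p = 2` this is a group of order `64`; an exhaustive machine check outside Lean also gives
`ρ₀(G_2) = 1`, so Thm. 5.1's STATEMENT is not refuted by `G_2` — only its printed proof.)

## What is here (all proved; one definition — the group — and 0 named facts)

* `SpecialP6 p` (structure, fields `v t : Fin 3 → ZMod p`) with its `Group` instance, the pairing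
  `SpecialP6.B`, `commute_iff`, `natCard = p⁶`, `mem_center_iff` / `natCard_center = p³`,
  `quotient_center_comm`, `natCard_quotient_center = p³`, `isPGroup`;
* `SpecialP6.card_le_of_minors` (pairwise dependent vectors in `𝔽_p³` number `≤ p`),
  `SpecialP6.card_le_of_forall_commute` — an abelian subgroup has order `≤ p⁴`;
* `SpecialP6.no_abelian_index_p` — no subgroup of index `p` is abelian;
* `Murthy2026_prop217_2_false` — the printed Prop. 2.17 (2) is false (witness `p = 2`).

## References
* S. R. Murthy, arXiv:2602.15796 (2026): Prop. 2.17 (p. 11), proof of Thm. 5.1 (p. 16). [Murthy2026]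
-/

namespace Literature.GroupTheory.SpecificGroups

/-- **The special class-2 group `G_p = 𝔽_p³ × 𝔽_p³`**, `(a, s)(b, t) = (a + b, s + t + B(a, b))` with
`B(a, b) = (a₀b₁, a₀b₂, a₁b₂)`. [cite: Murthy2026, Proposition 2.17 (counterexample to part (2))] -/
@[ext]
structure SpecialP6 (p : ℕ) where
  /-- vector part `a ∈ 𝔽_p³` -/
  v : Fin 3 → ZMod p
  /-- central part `s ∈ 𝔽_p³` -/
  t : Fin 3 → ZMod p

namespace SpecialP6

variable {p : ℕ}

/-- the pairing `B(a, b) = (a₀b₁, a₀b₂, a₁b₂)`. [cite: Murthy2026, Proposition 2.17 (counterexample)] -/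
def B (a b : Fin 3 → ZMod p) : Fin 3 → ZMod p := ![a 0 * b 1, a 0 * b 2, a 1 * b 2]

/-- `B(a,b)₀ = a₀b₁`. [cite: Murthy2026, Proposition 2.17 (counterexample)] -/
@[simp] theorem B_zero (a b : Fin 3 → ZMod p) : B a b 0 = a 0 * b 1 := rfl
/-- `B(a,b)₁ = a₀b₂`. [cite: Murthy2026, Proposition 2.17 (counterexample)] -/
@[simp] theorem B_one (a b : Fin 3 → ZMod p) : B a b 1 = a 0 * b 2 := rfl
/-- `B(a,b)₂ = a₁b₂`. [cite: Murthy2026, Proposition 2.17 (counterexample)] -/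
@[simp] theorem B_two (a b : Fin 3 → ZMod p) : B a b 2 = a 1 * b 2 := rfl

/-- `(a, s)(b, t) = (a + b, s + t + B(a, b))`. [cite: Murthy2026, Proposition 2.17 (counterexample)] -/
instance : Mul (SpecialP6 p) := ⟨fun x y => ⟨x.v + y.v, x.t + y.t + B x.v y.v⟩⟩
/-- unit `(0, 0)`. [cite: Murthy2026, Proposition 2.17 (counterexample)] -/
instance : One (SpecialP6 p) := ⟨⟨0, 0⟩⟩
/-- `(a, s)⁻¹ = (−a, −s + B(a, a))`. [cite: Murthy2026, Proposition 2.17 (counterexample)] -/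
instance : Inv (SpecialP6 p) := ⟨fun x => ⟨-x.v, -x.t + B x.v x.v⟩⟩

/-- vector part of a product. [cite: Murthy2026, Proposition 2.17 (counterexample)] -/
@[simp] theorem mul_v (x y : SpecialP6 p) : (x * y).v = x.v + y.v := rfl
/-- central part of a product. [cite: Murthy2026, Proposition 2.17 (counterexample)] -/
@[simp] theorem mul_t (x y : SpecialP6 p) : (x * y).t = x.t + y.t + B x.v y.v := rfl
/-- vector part of `1`. [cite: Murthy2026, Proposition 2.17 (counterexample)] -/
@[simp] theorem one_v : (1 : SpecialP6 p).v = 0 := rfl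
/-- central part of `1`. [cite: Murthy2026, Proposition 2.17 (counterexample)] -/
@[simp] theorem one_t : (1 : SpecialP6 p).t = 0 := rfl
/-- vector part of the inverse. [cite: Murthy2026, Proposition 2.17 (counterexample)] -/
@[simp] theorem inv_v (x : SpecialP6 p) : x⁻¹.v = -x.v := rfl
/-- central part of the inverse. [cite: Murthy2026, Proposition 2.17 (counterexample)] -/
@[simp] theorem inv_t (x : SpecialP6 p) : x⁻¹.t = -x.t + B x.v x.v := rfl

/-- `G_p` is a group (associativity = bilinearity of `B`). [cite: Murthy2026, Proposition 2.17
(counterexample)] -/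
instance : Group (SpecialP6 p) where
  mul_assoc x y z := by
    ext i
    · simp only [mul_v, add_assoc]
    · simp only [mul_t, mul_v, Pi.add_apply]
      fin_cases i <;> simp <;> ring
  one_mul x := by
    ext i
    · simp only [mul_v, one_v, zero_add]
    · simp only [mul_t, one_t, one_v, Pi.add_apply, zero_add]
      fin_cases i <;> simp
  mul_one x := by
    ext i
    · simp only [mul_v, one_v, add_zero]
    · simp only [mul_t, one_t, one_v, Pi.add_apply, add_zero]
      fin_cases i <;> simp
  inv_mul_cancel x := by
    ext i
    · simp only [mul_v, inv_v, neg_add_cancel, one_v]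
    · simp only [mul_t, inv_t, inv_v, one_t, Pi.add_apply, Pi.neg_apply, Pi.zero_apply]
      fin_cases i <;> simp

/-- Two elements commute iff `B(a, b) = B(b, a)`, i.e. iff the three `2 × 2` minors of `(a, b)` vanish.
[cite: Murthy2026, Proposition 2.17 (counterexample)] -/
theorem commute_iff (x y : SpecialP6 p) :
    x * y = y * x ↔ x.v 0 * y.v 1 = y.v 0 * x.v 1 ∧ x.v 0 * y.v 2 = y.v 0 * x.v 2 ∧
      x.v 1 * y.v 2 = y.v 1 * x.v 2 := by
  constructor
  · intro h
    have ht := congrArg SpecialP6.t h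
    simp only [mul_t] at ht
    have key : B x.v y.v = B y.v x.v := by
      have : x.t + y.t + B x.v y.v = x.t + y.t + B y.v x.v := by rw [ht]; abel
      exact add_left_cancel this
    exact ⟨by simpa using congrFun key 0, by simpa using congrFun key 1, by simpa using congrFun key 2⟩
  · rintro ⟨h0, h1, h2⟩
    ext i
    · simp only [mul_v, add_comm]
    · simp only [mul_t, Pi.add_apply]
      fin_cases i <;> simp [h0, h1, h2] <;> ring

/-- `G_p ≃ 𝔽_p³ × 𝔽_p³` as sets. [folklore] -/
private def equivProd : SpecialP6 p ≃ (Fin 3 → ZMod p) × (Fin 3 → ZMod p) :=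
  ⟨fun x => (x.v, x.t), fun q => ⟨q.1, q.2⟩, fun _ => rfl, fun _ => rfl⟩

/-- `|G_p| = p⁶`. [cite: Murthy2026, Proposition 2.17 (counterexample)] -/
theorem natCard (p : ℕ) : Nat.card (SpecialP6 p) = p ^ 6 := by
  rw [Nat.card_congr equivProd, Nat.card_prod, Nat.card_fun, Nat.card_zmod, Nat.card_eq_fintype_card,
    Fintype.card_fin]
  ring

/-- `G_p` is finite. [cite: Murthy2026, Proposition 2.17 (counterexample)] -/
instance [NeZero p] : Finite (SpecialP6 p) := Finite.of_equiv _ equivProd.symm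

/-- The centre of `G_p` is `0 × 𝔽_p³` (`p` prime): `B(a, ·) = B(·, a)` for all arguments forces
`a = 0` (test against the unit vectors). [cite: Murthy2026, Proposition 2.17 (counterexample)] -/
theorem mem_center_iff [Fact p.Prime] (x : SpecialP6 p) : x ∈ Subgroup.center (SpecialP6 p) ↔ x.v = 0 := by
  rw [Subgroup.mem_center_iff]
  constructor
  · intro h
    obtain ⟨h01, h02, -⟩ := (commute_iff _ _).1 (h ⟨Pi.single 0 1, 0⟩)
    obtain ⟨h10, -, h12⟩ := (commute_iff _ _).1 (h ⟨Pi.single 1 1, 0⟩)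
    -- `y₀ = (e₀, 0)`: `1 · x₁ = x₀ · 0`, `1 · x₂ = x₀ · 0`; `y₁ = (e₁, 0)`: `0 · x₁ = x₀ · 1`, `1 · x₂ = x₁ · 0`
    have s00 : (Pi.single 0 1 : Fin 3 → ZMod p) 0 = 1 := Pi.single_eq_same _ _
    have s01 : (Pi.single 0 1 : Fin 3 → ZMod p) 1 = 0 := Pi.single_eq_of_ne (by decide) _
    have s02 : (Pi.single 0 1 : Fin 3 → ZMod p) 2 = 0 := Pi.single_eq_of_ne (by decide) _
    have s10 : (Pi.single 1 1 : Fin 3 → ZMod p) 0 = 0 := Pi.single_eq_of_ne (by decide) _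
    have s11 : (Pi.single 1 1 : Fin 3 → ZMod p) 1 = 1 := Pi.single_eq_same _ _
    have s12 : (Pi.single 1 1 : Fin 3 → ZMod p) 2 = 0 := Pi.single_eq_of_ne (by decide) _
    simp only [s00, s01, s02, one_mul, mul_zero] at h01 h02
    simp only [s10, s11, s12, zero_mul, mul_one, one_mul, mul_zero] at h10 h12
    funext i
    fin_cases i
    · exact h10.symm
    · exact h01
    · exact h02
  · intro hv y
    rw [commute_iff]
    simp [hv]

/-- the central part as an equivalence `Z(G_p) ≃ 𝔽_p³`. [folklore] -/
private def centerEquiv [Fact p.Prime] : Subgroup.center (SpecialP6 p) ≃ (Fin 3 → ZMod p) where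
  toFun z := z.1.t
  invFun s := ⟨⟨0, s⟩, (mem_center_iff _).2 rfl⟩
  left_inv z := by
    apply Subtype.ext
    apply SpecialP6.ext
    · exact ((mem_center_iff _).1 z.2).symm
    · rfl
  right_inv _ := rfl

/-- `|Z(G_p)| = p³`. [cite: Murthy2026, Proposition 2.17 (counterexample)] -/
theorem natCard_center [Fact p.Prime] : Nat.card (Subgroup.center (SpecialP6 p)) = p ^ 3 := by
  rw [Nat.card_congr centerEquiv, Nat.card_fun, Nat.card_zmod, Nat.card_eq_fintype_card,
    Fintype.card_fin]

/-- `G_p / Z(G_p)` is abelian (commutators have vector part `0`), i.e. `G_p` has class `≤ 2`.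
[cite: Murthy2026, Proposition 2.17 (counterexample)] -/
theorem quotient_center_comm [Fact p.Prime] (a b : SpecialP6 p ⧸ Subgroup.center (SpecialP6 p)) :
    a * b = b * a := by
  obtain ⟨x, rfl⟩ := QuotientGroup.mk_surjective a
  obtain ⟨y, rfl⟩ := QuotientGroup.mk_surjective b
  rw [← QuotientGroup.mk_mul, ← QuotientGroup.mk_mul, QuotientGroup.eq, mem_center_iff]
  simp only [mul_v, inv_v, neg_add_rev]
  abel

/-- `|G_p / Z(G_p)| = p³`. [cite: Murthy2026, Proposition 2.17 (counterexample)] -/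
theorem natCard_quotient_center [Fact p.Prime] :
    Nat.card (SpecialP6 p ⧸ Subgroup.center (SpecialP6 p)) = p ^ 3 := by
  have h := Subgroup.card_eq_card_quotient_mul_card_subgroup (Subgroup.center (SpecialP6 p))
  rw [natCard, natCard_center] at h
  have hp : 0 < p ^ 3 := pow_pos (Fact.out : p.Prime).pos 3
  have : p ^ 3 * p ^ 3 = Nat.card (SpecialP6 p ⧸ Subgroup.center (SpecialP6 p)) * p ^ 3 := by
    rw [← h]; ring
  exact (Nat.eq_of_mul_eq_mul_right hp this).symm

/-- `G_p` is a `p`-group. [cite: Murthy2026, Proposition 2.17 (counterexample)] -/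
theorem isPGroup [Fact p.Prime] : IsPGroup p (SpecialP6 p) := IsPGroup.of_card (natCard p)

/-- the vector-part homomorphism `G_p → 𝔽_p³`. [folklore] -/
private def vHom : SpecialP6 p →* Multiplicative (Fin 3 → ZMod p) where
  toFun x := Multiplicative.ofAdd x.v
  map_one' := rfl
  map_mul' _ _ := rfl

/-- **Pairwise dependent vectors are few**: a subgroup `W ≤ 𝔽_p³` in which all pairs have vanishing
`2 × 2` minors has at most `p` elements (all are multiples of one of them).
[cite: Murthy2026, Proposition 2.17 (counterexample)] -/
theorem card_le_of_minors [Fact p.Prime] (W : Subgroup (Multiplicative (Fin 3 → ZMod p)))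
    (hW : ∀ a ∈ W, ∀ b ∈ W,
      (Multiplicative.toAdd a) 0 * (Multiplicative.toAdd b) 1 =
          (Multiplicative.toAdd b) 0 * (Multiplicative.toAdd a) 1 ∧
        (Multiplicative.toAdd a) 0 * (Multiplicative.toAdd b) 2 =
          (Multiplicative.toAdd b) 0 * (Multiplicative.toAdd a) 2 ∧
        (Multiplicative.toAdd a) 1 * (Multiplicative.toAdd b) 2 =
          (Multiplicative.toAdd b) 1 * (Multiplicative.toAdd a) 2) :
    Nat.card W ≤ p := by
  classical
  haveI : NeZero p := ⟨(Fact.out : p.Prime).ne_zero⟩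
  by_cases hbot : ∀ a ∈ W, Multiplicative.toAdd a = 0
  · -- `W = ⊥`
    have : W = ⊥ := (Subgroup.eq_bot_iff_forall _).2 fun a ha => by
      have := hbot a ha
      exact Multiplicative.toAdd.injective (by simpa using this)
    subst this
    simp only [Subgroup.card_bot]
    exact (Fact.out : p.Prime).one_lt.le
  · obtain ⟨a, ha'⟩ := not_forall.1 hbot
    obtain ⟨haW, ha⟩ := Classical.not_imp.1 ha'
    obtain ⟨i, hi⟩ : ∃ i, Multiplicative.toAdd a i ≠ 0 := by
      by_contra hcon
      apply ha
      funext i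
      by_contra hi
      exact hcon ⟨i, hi⟩
    -- `b ↦ b i` is injective on `W`
    have hinj : Function.Injective (fun b : W => (Multiplicative.toAdd b.1) i) := by
      rintro ⟨b, hb⟩ ⟨b', hb'⟩ he
      simp only at he
      apply Subtype.ext
      apply Multiplicative.toAdd.injective
      obtain ⟨e1, e2, e3⟩ := hW a haW b hb
      obtain ⟨f1, f2, f3⟩ := hW a haW b' hb'
      set A := Multiplicative.toAdd a with hA
      set X := Multiplicative.toAdd b with hX
      set Y := Multiplicative.toAdd b' with hY
      -- all coordinates of `X`, `Y` are determined by the `i`-th one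
      have key : ∀ j k : Fin 3, A j * X k = X j * A k → A j * Y k = Y j * A k → A j ≠ 0 → X j = Y j →
          X k = Y k := by
        intro j k e f hj hXY
        have : A j * X k = A j * Y k := by rw [e, f, hXY]
        exact mul_left_cancel₀ hj this
      funext k
      fin_cases i <;> fin_cases k
      · exact he
      · exact key 0 1 e1 f1 hi he
      · exact key 0 2 e2 f2 hi he
      · -- i = 1, k = 0: use the (0,1) minor read backwards
        have e1' : A 1 * X 0 = X 1 * A 0 := by
          have := e1; linear_combination (-1 : ZMod p) * this
        have f1' : A 1 * Y 0 = Y 1 * A 0 := by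
          have := f1; linear_combination (-1 : ZMod p) * this
        exact key 1 0 e1' f1' hi he
      · exact he
      · exact key 1 2 e3 f3 hi he
      · have e2' : A 2 * X 0 = X 2 * A 0 := by
          have := e2; linear_combination (-1 : ZMod p) * this
        have f2' : A 2 * Y 0 = Y 2 * A 0 := by
          have := f2; linear_combination (-1 : ZMod p) * this
        exact key 2 0 e2' f2' hi he
      · have e3' : A 2 * X 1 = X 2 * A 1 := by
          have := e3; linear_combination (-1 : ZMod p) * this
        have f3' : A 2 * Y 1 = Y 2 * A 1 := by
          have := f3; linear_combination (-1 : ZMod p) * this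
        exact key 2 1 e3' f3' hi he
      · exact he
    calc Nat.card W ≤ Nat.card (ZMod p) := Nat.card_le_card_of_injective _ hinj
      _ = p := Nat.card_zmod p

/-- **An abelian subgroup of `G_p` has order at most `p⁴`**: its vector parts are pairwise dependent
(`commute_iff`), so the image in `𝔽_p³` has `≤ p` elements, and the kernel lies in `0 × 𝔽_p³`.
[cite: Murthy2026, Proposition 2.17 (counterexample)] -/
theorem card_le_of_forall_commute [Fact p.Prime] (M : Subgroup (SpecialP6 p))
    (hM : ∀ x ∈ M, ∀ y ∈ M, x * y = y * x) : Nat.card M ≤ p ^ 4 := by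
  classical
  haveI : NeZero p := ⟨(Fact.out : p.Prime).ne_zero⟩
  -- first isomorphism theorem for `vHom` restricted to `M`
  let f : M →* Multiplicative (Fin 3 → ZMod p) := vHom.restrict M
  have hsplit : Nat.card M = Nat.card f.range * Nat.card f.ker := by
    rw [Subgroup.card_eq_card_quotient_mul_card_subgroup f.ker,
      Nat.card_congr (QuotientGroup.quotientKerEquivRange f).toEquiv]
  -- the image consists of pairwise dependent vectors
  have hrange : Nat.card f.range ≤ p := by
    refine card_le_of_minors f.range ?_
    rintro _ ⟨⟨x, hx⟩, rfl⟩ _ ⟨⟨y, hy⟩, rfl⟩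
    exact (commute_iff x y).1 (hM x hx y hy)
  -- the kernel embeds into `0 × 𝔽_p³`
  have hker : Nat.card f.ker ≤ p ^ 3 := by
    have hinj : Function.Injective (fun z : f.ker => ((z : M) : SpecialP6 p).t) := by
      rintro ⟨⟨z, hzM⟩, hz⟩ ⟨⟨z', hz'M⟩, hz'⟩ he
      simp only at he
      have hv : z.v = 0 :=
        Multiplicative.ofAdd.injective (show Multiplicative.ofAdd z.v = Multiplicative.ofAdd 0 from hz)
      have hv' : z'.v = 0 :=
        Multiplicative.ofAdd.injective (show Multiplicative.ofAdd z'.v = Multiplicative.ofAdd 0 from hz')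
      apply Subtype.ext; apply Subtype.ext
      exact SpecialP6.ext (by rw [hv, hv']) he
    calc Nat.card f.ker ≤ Nat.card (Fin 3 → ZMod p) := Nat.card_le_card_of_injective _ hinj
      _ = p ^ 3 := by rw [Nat.card_fun, Nat.card_zmod, Nat.card_eq_fintype_card, Fintype.card_fin]
  calc Nat.card M = Nat.card f.range * Nat.card f.ker := hsplit
    _ ≤ p * p ^ 3 := Nat.mul_le_mul hrange hker
    _ = p ^ 4 := by ring

/-- **`G_p` has no abelian subgroup of index `p`** (such a subgroup would have order `p⁵ > p⁴`).
[cite: Murthy2026, Proposition 2.17 (counterexample to part (2))] -/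
theorem no_abelian_index_p [Fact p.Prime] (M : Subgroup (SpecialP6 p)) (hM : M.index = p) :
    ¬ (∀ x ∈ M, ∀ y ∈ M, x * y = y * x) := by
  intro hcomm
  have hp := (Fact.out : p.Prime)
  have hcard : Nat.card M * p = p ^ 6 := by
    have h := Subgroup.card_mul_index M
    rwa [hM, natCard] at h
  have hM5 : Nat.card M = p ^ 5 := by
    have : Nat.card M * p = p ^ 5 * p := by rw [hcard]; ring
    exact Nat.eq_of_mul_eq_mul_right hp.pos this
  have hle := card_le_of_forall_commute M hcomm
  rw [hM5] at hle
  have : p ^ 4 < p ^ 5 := Nat.pow_lt_pow_right hp.one_lt (by norm_num)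
  exact absurd hle (not_le.2 this)

end SpecialP6

/-- **Murthy 2026, Proposition 2.17 (2) as printed is false**: there is a finite `p`-group (here
`p = 2`, the group `SpecialP6 2` of order `64`) with `G/Z(G)` abelian of order `p³` and NO abelian
subgroup of index `p`. [cite: Murthy2026, Proposition 2.17] -/
theorem Murthy2026_prop217_2_false :
    ¬ (∀ (G : Type) [Group G] [Finite G] (p : ℕ), p.Prime → IsPGroup p G →
        (∀ a b : G ⧸ Subgroup.center G, a * b = b * a) →
        Nat.card (G ⧸ Subgroup.center G) = p ^ 3 →
        ∃ A : Subgroup G, A.index = p ∧ ∀ x ∈ A, ∀ y ∈ A, x * y = y * x) := by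
  intro h
  haveI : Fact (Nat.Prime 2) := ⟨Nat.prime_two⟩
  obtain ⟨A, hA, hcomm⟩ := h (SpecialP6 2) 2 Nat.prime_two SpecialP6.isPGroup
    SpecialP6.quotient_center_comm SpecialP6.natCard_quotient_center
  exact SpecialP6.no_abelian_index_p A hA hcomm

end Literature.GroupTheory.SpecificGroups
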